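import Literature.Barriers.ABC.BakerMethodBoundsKummerPlaceBoundsProofs
import Literature.Barriers.ABC.BakerMethodBoundsKummerArchProofs
import HarnessLib

/-!
# Proofs for `BakerMethodBounds`, VII-B: the Kummer second regime and the assembly from the two `p`-adic PLACE BOUNDS

`Literature/Barriers/ABC/BakerMethodBoundsKummerPlaceBoundsRegimeTwoProofs.lean` — sequel to
`BakerMethodBoundsKummerPlaceBoundsProofs.lean` (theorems only; no definition, no named fact): verbatim re-run of file VI's
Kummer second regime `log_le_of_sq_lt_kummer₂` (`a² < c`: the `2`-Kummer descent on `≤ 4` logarithms with the archimedean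
binder `hW₂` of shape `Literature.NumberTheory.Transcendental.Waldschmidt1980.waldschmidt1980_hW₂`, and the `p`-adic bounds for
the smooth parts through `log_le_of_primes_le_placeBounds` / `logHeight₁_smooth_le_placeBounds`) and of the assembly
`bakerShapeBound_third_three_of_padicClause_kummerArchBound₂` / `BakerMethodBounds_of_padicClause_kummerArchBound₂`, with the
rational `p`-adic clause `hP2` replaced by the two `p`-adic place bounds (p ∣ a) / (p ∣ c) at threshold `N = 0`.  Result:
`BakerMethodBounds_of_placeBounds_kummerArchBound₂ hK hpad hpadc Cw hCw hW₂ : BakerMethodBounds` — the door through which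
`p`-adic bounds for rational PRIMES of Yu-2007 quality give Stewart–Yu 2001's exponent `1/3` once `hW₂` is discharged by the
tree (`waldschmidt1980_hW₂`).  No new mathematics. [cite: StewartYu2001, Theorem 1] [cite: Waldschmidt1980, Prop. 3.8]

## References

* [StewartYu2001] C. L. Stewart, K. Yu, *On the abc conjecture, II*, Duke Math. J. 108 (2001), 169–181 — Theorem 1, §3.
* [Waldschmidt1980] M. Waldschmidt, Acta Arith. 37 (1980) — Prop. 3.8.
* [Pasten2024] H. Pasten, Invent. Math. 236 (2024) — §§4–5.
-/

noncomputable section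

open Finset Real Height Polynomial IntermediateField
open Literature.NumberTheory.DiophantineGeometry
open Literature.NumberTheory.DiophantineGeometry.Dioph
open Literature.NumberTheory.DiophantineGeometry.Pasten

namespace Literature.Barriers.ABC

section RegimeTwoKummerPlaceBounds

variable {K : ℝ} {a b c : ℕ}

set_option maxHeartbeats 800000 in
/-- **Second regime, Kummer version, from the `E = 2` form `hW₂` of the archimedean bound.** For an abc triple with `a ≤ b`, `ab > 1` and `a² < c`:
`log c ≤ 1800 C⋆ D K C₁² · R^{7/24} · Λ⁶ · Y²`, with `Λ = max(1, log R)`, `Y = log max{e, 2 log c}`,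
`C⋆ = max(1, Cw(2), Cw(3), Cw(4))`, `D = log 6 + log K + 2 log C₁ + 8`, `C₁` the constant of
`exists_prod_two_mul_max_log_le`; from the `p`-adic clause (constant `K`) and a lower bound
for linear forms in `≤ 4` logarithms of positive rationals of the shape of Waldschmidt's
Proposition 3.8 (under the `2`-Kummer condition) with ANY constant `Cw(n) ≥ 0`.
Proof: as in `log_le_of_sq_lt` (`log c < 2 + 2 log(1/log(c/b))`, `c/b = β · ∏_{q > R^{1/4}} q^{e_q}`
with `β` the `R^{1/4}`-smooth part, at most three large primes, `h(β) ≤ 6 K J² R^{1/4} Y` paid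
`p`-adically at the small primes), except that the archimedean bound is applied to the
generators `{q > R^{1/4}} ∪ {β₀}` where `β = β₀^{2ʲ}` with `β₀` NOT A SQUARE
(`exists_eq_pow_two_pow_of_pos`): distinct primes and a non-square unit at those primes have
independent square classes, so `[ℚ(√q (q large), √β₀) : ℚ] = 2ⁿ` (`kummer_arch_lower_bound₂`);
the coefficient `2ʲ ≤ 2 h(β)` of `log β₀` and Waldschmidt's two extra logarithmic factors cost
only `log`'s of `R` and `log c` (`regimeIIK_logs`): `Λ⁶ Y²` instead of `Λ³ Y²`.
[cite: StewartYu2001, Theorem 1 (proof), as reconstructed] [cite: Waldschmidt1980, Prop 3.8 (p. 274)] -/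
theorem log_le_of_sq_lt_kummer₂_placeBounds (hK : 1 ≤ K)
    (hpad : ∀ {a b c : ℕ}, IsABCTriple a b c → ∀ {p : ℕ}, p.Prime → p ∣ a →
      (a.factorization p : ℝ) * Real.log p < theta K b c 0 *
        ((p / Real.log p) * (Real.log p + Real.log (max (Real.exp 1) (2 * Real.log c)))))
    (hpadc : ∀ {a b c : ℕ}, IsABCTriple a b c → 1 < a * b → ∀ {p : ℕ}, p.Prime → p ∣ c →
      (c.factorization p : ℝ) * Real.log p < theta K a b 0 *
        ((p / Real.log p) * (Real.log p + Real.log (max (Real.exp 1) (2 * Real.log c)))))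
    (Cw : ℕ → ℝ) (hCw : ∀ n, 0 ≤ Cw n)
    (hW₂ : ∀ (n : ℕ) (α : Fin (n + 1) → ℚ) (b : Fin (n + 1) → ℤ) (V : Fin (n + 1) → ℝ) (W : ℝ),
      (∀ j, 0 < α j ∧ α j ≠ 1) →
      Module.finrank ℚ ↥(IntermediateField.adjoin ℚ
          (Set.range fun j => Real.sqrt (α j : ℝ))) = 2 ^ (n + 1) →
      Monotone V → 1 ≤ V 0 →
      (∀ j, max (logHeight₁ (α j)) |Real.log (α j : ℝ)| ≤ V j) →
      0 < W → (∀ j, logHeight₁ (b j : ℚ) ≤ W) →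
      ∑ j, (b j : ℝ) * Real.log (α j : ℝ) ≠ 0 →
      Real.exp (-(Cw (n + 1) * (∏ j, V j) * (W + Real.log (2 * V (Fin.last n))) *
          Real.log (2 * (if n = 0 then 1 else V ⟨n - 1, by omega⟩)) / Real.log 2 ^ (n + 2))) <
        |∑ j, (b j : ℝ) * Real.log (α j : ℝ)|)
    {C₁ : ℝ} (hC₁1 : 1 ≤ C₁)
    (hC₁ : ∀ S : Finset ℕ, (∀ p ∈ S, p.Prime) →
      ∏ p ∈ S, 2 * K * max 1 (Real.log p) ≤ C₁ * (∏ p ∈ S, (p : ℝ)) ^ (1 / 48 : ℝ))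
    (h : IsABCTriple a b c) (hab : a ≤ b) (h1 : 1 < a * b) (hac2 : (a : ℝ) ^ 2 < c) :
    Real.log c ≤ 1800 * max 1 (max (max (Cw 2) (Cw 3)) (Cw 4)) *
      (Real.log 6 + Real.log K + 2 * Real.log C₁ + 8) * K * C₁ ^ 2 *
      (rad a b c : ℝ) ^ (7 / 24 : ℝ) * max 1 (Real.log (rad a b c : ℕ)) ^ 6 *
      Real.log (max (Real.exp 1) (2 * Real.log c)) ^ 2 := by
  classical
  obtain ⟨ha, hb, habc, hcop⟩ := id h
  have hc : c ≠ 0 := by omega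
  have hbc : b.Coprime c := coprime_right_of_isABCTriple h
  have hcb : c.Coprime b := hbc.symm
  have hac : a.Coprime c := coprime_left_of_isABCTriple h
  have habc0 : a * b * c ≠ 0 := by positivity
  have hK0 : 0 ≤ K := zero_le_one.trans hK
  have ha_r : (0 : ℝ) < a := by exact_mod_cast ha
  have hb_r : (0 : ℝ) < b := by exact_mod_cast hb
  have hc_r : (0 : ℝ) < c := by exact_mod_cast Nat.pos_of_ne_zero hc
  have hbc_lt : (b : ℝ) < c := by exact_mod_cast (show b < c by omega)
  have hab_r : (a : ℝ) ≤ b := by exact_mod_cast hab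
  -- notation
  set R : ℕ := rad a b c with hRdef
  have hR0n : R ≠ 0 := by
    rw [hRdef, rad_def]; exact UniqueFactorizationMonoid.radical_ne_zero
  have hR1 : (1 : ℝ) ≤ (R : ℝ) := one_le_rad_real a b c
  have hR0 : (0 : ℝ) < R := by linarith
  set Λ : ℝ := max 1 (Real.log (R : ℝ)) with hΛdef
  have hΛ1 : 1 ≤ Λ := le_max_left _ _
  have hΛ0 : 0 < Λ := by linarith
  set τ : ℝ := (R : ℝ) ^ (1 / 4 : ℝ) with hτdef
  have hτ1 : 1 ≤ τ := Real.one_le_rpow hR1 (by norm_num)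
  set y : ℝ := Real.log c with hydef
  have hy0 : 0 < y := Real.log_pos (by exact_mod_cast (show 1 < c by omega))
  set Y : ℝ := Real.log (max (Real.exp 1) (2 * Real.log c)) with hYdef
  have hY1 : 1 ≤ Y := one_le_log_max_exp _
  set Cmax : ℝ := max (max (Cw 2) (Cw 3)) (Cw 4) with hCmax
  set C' : ℝ := max 1 Cmax with hC'
  have hC'1 : 1 ≤ C' := le_max_left _ _
  have hCle : ∀ n, 2 ≤ n → n ≤ 4 → Cw n ≤ C' := fun n hn2 hn4 => by
    rw [hC', hCmax]; exact apply_le_max_four Cw hn2 hn4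
  set D : ℝ := Real.log 6 + Real.log K + 2 * Real.log C₁ + 8 with hDdef
  have hD1 : 1 ≤ D := by
    have h6 : 0 ≤ Real.log 6 := Real.log_nonneg (by norm_num)
    have hK' : 0 ≤ Real.log K := Real.log_nonneg hK
    have hC₁' : 0 ≤ Real.log C₁ := Real.log_nonneg hC₁1
    rw [hDdef]; linarith
  set J : ℝ := ∏ q ∈ (a * b * c).primeFactors, 2 * K * max 1 (Real.log q) with hJdef
  have hJ1 : 1 ≤ J := one_le_prod_two_mul_max hK _
  have hΘab : theta K a b 0 ≤ K * J :=
    theta_zero_le_mul_prod hK ha.ne' hb.ne' hcop habc0 (Dvd.intro c rfl)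
  have hΘac : theta K a c 0 ≤ K * J :=
    theta_zero_le_mul_prod hK ha.ne' hc hac habc0 (Dvd.intro b (by ring))
  have hΘab0 : 0 ≤ theta K a b 0 := theta_nonneg hK0 a b 0
  have hΘac0 : 0 ≤ theta K a c 0 := theta_nonneg hK0 a c 0
  -- `J ≤ C₁ R^{1/48}`
  have hJle : J ≤ C₁ * (R : ℝ) ^ (1 / 48 : ℝ) := by
    have h1' := hC₁ (a * b * c).primeFactors fun q hq => Nat.prime_of_mem_primeFactors hq
    have hprod : ∏ q ∈ (a * b * c).primeFactors, (q : ℝ) = R := by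
      rw [hRdef, rad_def, Nat.radical_eq_prod_primeFactors, Nat.cast_prod]
    rwa [hprod] at h1'
  -- primes of `cb`, small and large
  set P : Finset ℕ := (c * b).primeFactors with hPdef
  have hcbdvd : c * b ∣ a * b * c := Dvd.intro_left a (by ring)
  have hPsub : P ⊆ (a * b * c).primeFactors := Nat.primeFactors_mono hcbdvd habc0
  have hPprime : ∀ q ∈ P, q.Prime := fun q hq => Nat.prime_of_mem_primeFactors hq
  have hcardP : (P.card : ℝ) ≤ J :=
    le_trans (by exact_mod_cast Finset.card_le_card hPsub) (card_primeFactors_le_prod hK _)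
  set S : Finset ℕ := P.filter (fun q => (q : ℝ) ≤ τ) with hSdef
  set L : Finset ℕ := P.filter (fun q => ¬(q : ℝ) ≤ τ) with hLdef
  have hSsub : S ⊆ P := Finset.filter_subset _ _
  have hLsub : L ⊆ P := Finset.filter_subset _ _
  have hSτ : ∀ q ∈ S, (q : ℝ) ≤ τ := fun q hq => (Finset.mem_filter.mp hq).2
  have hLτ : ∀ q ∈ L, τ < q := fun q hq => lt_of_not_ge (Finset.mem_filter.mp hq).2
  have hLprime : ∀ q ∈ L, q.Prime := fun q hq => hPprime q (hLsub hq)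
  have hcardS : (S.card : ℝ) ≤ J :=
    le_trans (by exact_mod_cast Finset.card_le_card hSsub) hcardP
  -- at most three large primes
  have hL3 : L.card ≤ 3 := by
    refine card_le_three_of_quarter_lt hR0n L ?_ hLτ
    have h1' : ∏ q ∈ L, q ∣ ∏ q ∈ (a * b * c).primeFactors, q :=
      Finset.prod_dvd_prod_of_subset _ _ _ (hLsub.trans hPsub)
    rwa [← Nat.radical_eq_prod_primeFactors, ← rad_def] at h1'
  -- `log q ≤ Λ` on `P`
  have hlogP : ∀ q ∈ P, Real.log q ≤ Λ := by
    intro q hq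
    have hqp := hPprime q hq
    have hqR : (q : ℝ) ≤ R := by
      exact_mod_cast prime_le_rad hqp ((Nat.dvd_of_mem_primeFactors hq).trans hcbdvd) habc0
    exact (Real.log_le_log (by exact_mod_cast hqp.pos) hqR).trans (le_max_right _ _)
  -- the smooth part `β` and the splitting of `c/b`
  set e : ℕ → ℤ := expDiff c b with hedef
  set β : ℚ := ∏ q ∈ S, (q : ℚ) ^ e q with hβdef
  have hβpos : 0 < β := Finset.prod_pos fun q hq =>
    zpow_pos (by exact_mod_cast (hPprime q (hSsub hq)).pos) _
  have hsplitQ : (c : ℚ) / b = β * ∏ q ∈ L, (q : ℚ) ^ e q := by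
    rw [cast_div_eq_prod_zpow hc hb.ne' hcb, hβdef, hSdef, hLdef,
      Finset.prod_filter_mul_prod_filter_not]
  set Λ₀ : ℝ := Real.log c - Real.log b with hΛ₀def
  have hΛ₀eq : Λ₀ = Real.log (β : ℝ) + ∑ q ∈ L, (e q : ℝ) * Real.log q := by
    have hcast : (((c : ℚ) / b : ℚ) : ℝ) = (c : ℝ) / b := by push_cast; rfl
    have hq0 : ∀ q ∈ L, ((q : ℝ)) ^ e q ≠ 0 := fun q hq =>
      zpow_ne_zero _ (by exact_mod_cast (hLprime q hq).ne_zero)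
    have h2 : (((c : ℚ) / b : ℚ) : ℝ) = (β : ℝ) * ∏ q ∈ L, (q : ℝ) ^ e q := by
      rw [hsplitQ]; push_cast; rfl
    have hβr : (β : ℝ) ≠ 0 := by exact_mod_cast hβpos.ne'
    have hprod0 : ∏ q ∈ L, (q : ℝ) ^ e q ≠ 0 := Finset.prod_ne_zero_iff.mpr hq0
    calc Λ₀ = Real.log ((c : ℝ) / b) := (Real.log_div hc_r.ne' hb_r.ne').symm
      _ = Real.log ((β : ℝ) * ∏ q ∈ L, (q : ℝ) ^ e q) := by rw [← hcast, h2]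
      _ = Real.log (β : ℝ) + ∑ q ∈ L, Real.log ((q : ℝ) ^ e q) := by
          rw [Real.log_mul hβr hprod0, Real.log_prod hq0]
      _ = Real.log (β : ℝ) + ∑ q ∈ L, (e q : ℝ) * Real.log q := by
          congr 1
          exact Finset.sum_congr rfl fun q _ => Real.log_zpow _ _
  -- `0 < Λ₀ ≤ a/b ≤ 1`
  have hΛ₀pos : 0 < Λ₀ := by
    rw [hΛ₀def]; linarith only [Real.log_lt_log hb_r hbc_lt]
  have hΛ₀le : Λ₀ ≤ (a : ℝ) / b := by
    have h1' : Real.log ((c : ℝ) / b) ≤ (c : ℝ) / b - 1 := Real.log_le_sub_one_of_pos (by positivity)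
    have h2 : (c : ℝ) / b - 1 = (a : ℝ) / b := by
      have : (c : ℝ) = a + b := by exact_mod_cast habc.symm
      rw [this, add_div, div_self hb_r.ne']; ring
    rw [hΛ₀def, ← Real.log_div hc_r.ne' hb_r.ne']
    linarith only [h1', h2]
  have hab1 : (a : ℝ) / b ≤ 1 := (div_le_one hb_r).mpr hab_r
  -- `y < 2 + 2 · (−log Λ₀)`
  have hstar : y < 2 + 2 * (-Real.log Λ₀) := by
    have h2a : 2 * Real.log a < y := by
      have h' : Real.log ((a : ℝ) ^ 2) < Real.log c := Real.log_lt_log (by positivity) hac2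
      have h'' : Real.log ((a : ℝ) ^ 2) = 2 * Real.log a := by
        rw [Real.log_pow]; push_cast; ring
      rw [hydef]; linarith only [h', h'']
    have hlogΛ₀ : Real.log Λ₀ ≤ Real.log a - Real.log b := by
      rw [← Real.log_div ha_r.ne' hb_r.ne']
      exact Real.log_le_log hΛ₀pos hΛ₀le
    have hΛ₀1 : Λ₀ ≤ 1 := hΛ₀le.trans hab1
    have hyΛ : y - Real.log a = Λ₀ + (Real.log b - Real.log a) := by rw [hΛ₀def]; ring
    linarith only [h2a, hlogΛ₀, hΛ₀1, hyΛ]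
  -- exponents: `|e_q| ≤ 1 + 3y`
  set Bₑ : ℝ := 1 + 3 * y with hBₑdef
  have hBₑ1 : 1 ≤ Bₑ := by rw [hBₑdef]; linarith
  have hBₑ : ∀ q ∈ L, (|e q| : ℝ) ≤ Bₑ := by
    intro q hq
    have hqp := hLprime q hq
    have hnat : (|e q| : ℝ) = ((expDiff c b q).natAbs : ℝ) := by
      rw [Nat.cast_natAbs, Int.cast_abs]
    rw [hnat, natAbs_expDiff hc hb.ne' hcb q]
    have h1' := factorization_le_log (mul_ne_zero hc hb.ne') hqp
    have h2 : Real.log ((c * b : ℕ) : ℝ) ≤ 2 * y := by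
      push_cast
      rw [Real.log_mul hc_r.ne' hb_r.ne', hydef]
      linarith only [Real.log_le_log hb_r hbc_lt.le]
    have h3 : (0 : ℝ) ≤ y := hy0.le
    rw [hBₑdef]; linarith only [h1', h2, h3]
  have hlogBₑ : Real.log (Real.exp 1 * Bₑ) ≤ 4 * Y := by
    rw [hBₑdef, hYdef]; exact log_exp_mul_le_four_mul hy0.le
  have he2 : (2 : ℝ) ≤ Real.exp 1 := by have := Real.add_one_le_exp (1 : ℝ); linarith
  have hlogBₑ0 : 0 ≤ Real.log (Real.exp 1 * Bₑ) :=
    Real.log_nonneg (one_le_mul_of_one_le_of_one_le (by linarith) hBₑ1)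
  -- `(log 2)^{-(k+2)} ≤ 32`, `(log 2)^{-(k+1)} ≤ 16` for `k ≤ 3`
  have hlog2 : 0 < Real.log 2 := Real.log_pos one_lt_two
  have hinv : ∀ k, k ≤ 3 → 1 / Real.log 2 ^ (k + 2) ≤ 32 := fun k hk => by
    calc 1 / Real.log 2 ^ (k + 2) ≤ 2 ^ (k + 2) := inv_log_two_pow_le _
      _ ≤ 2 ^ 5 := pow_le_pow_right₀ (by norm_num) (by omega)
      _ = 32 := by norm_num
  have hinv' : ∀ k, k ≤ 3 → 1 / Real.log 2 ^ (k + 1) ≤ 16 := fun k hk => by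
    calc 1 / Real.log 2 ^ (k + 1) ≤ 2 ^ (k + 1) := inv_log_two_pow_le _
      _ ≤ 2 ^ 4 := pow_le_pow_right₀ (by norm_num) (by omega)
      _ = 16 := by norm_num
  have hlog2Λ : Real.log (2 * Λ) ≤ 2 * Λ := log_two_mul_le hΛ1
  have hlog2Λ0 : 0 ≤ Real.log (2 * Λ) := Real.log_nonneg (by linarith)
  have hΛpow : ∀ k, k ≤ 3 → Λ ^ k ≤ Λ ^ 3 := fun k hk => pow_le_pow_right₀ hΛ1 hk
  -- the target of all cases
  set Pₘ : ℝ := C' * D * K * J ^ 2 * τ * Λ ^ 6 with hPₘ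
  set M : ℝ := 1800 * Pₘ with hMdef
  have hMeq : 1800 * (C' * D * K * J ^ 2 * τ * Λ ^ 6) * Y ^ 2 = M * Y ^ 2 := by rw [hMdef]
  have hyM : y ≤ M * Y ^ 2 := by
    rcases Finset.eq_empty_or_nonempty L with hLe | hLne
    · -- every prime of `cb` is small: bound `log c` through the primes of `c` directly
      have hsmall : ∀ q ∈ c.primeFactors, (q : ℝ) ≤ τ := by
        intro q hq
        have hqP : q ∈ P := Nat.primeFactors_mono (Dvd.intro b rfl) (mul_ne_zero hc hb.ne') hq
        by_contra hqτ
        have : q ∈ L := Finset.mem_filter.mpr ⟨hqP, hqτ⟩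
        rw [hLe] at this
        exact Finset.notMem_empty q this
      have h1' := log_le_of_primes_le_placeBounds hK hpadc h h1 hsmall
      have hsubc : c.primeFactors ⊆ (a * b * c).primeFactors :=
        Nat.primeFactors_mono (Dvd.intro_left (a * b) rfl) habc0
      have hcardc : (c.primeFactors.card : ℝ) ≤ J :=
        le_trans (by exact_mod_cast Finset.card_le_card hsubc) (card_primeFactors_le_prod hK _)
      obtain ⟨-, hA2, -, -, -⟩ := regimeIIK_arith (Hs := 1 + 6 * K * J ^ 2 * τ * Y) hC'1 hD1 hK
        hJ1 hτ1 hΛ1 hY1 le_rfl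
      calc y ≤ c.primeFactors.card * (theta K a b 0 * (3 * τ * Y)) := h1'
        _ ≤ J * (K * J * (3 * τ * Y)) := by
            apply mul_le_mul hcardc _ (by positivity) (zero_le_one.trans hJ1)
            exact mul_le_mul_of_nonneg_right hΘab (by positivity)
        _ = 3 * (K * J ^ 2 * τ) * Y := by ring
        _ ≤ 1800 * (C' * D * K * J ^ 2 * τ * Λ ^ 6) * Y ^ 2 := hA2
        _ = M * Y ^ 2 := hMeq
    · rcases eq_or_ne β 1 with hβ1 | hβ1
      · -- `Λ₀ = ∑_{q ∈ L} e_q log q`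
        have hΛ₀eq' : Λ₀ = ∑ q ∈ L, (e q : ℝ) * Real.log q := by
          rw [hΛ₀eq, hβ1]; push_cast; rw [Real.log_one, zero_add]
        rcases le_or_gt 2 L.card with hL2 | hL2
        · have hne : ∑ q ∈ L, (e q : ℝ) * Real.log q ≠ 0 := by rw [← hΛ₀eq']; exact hΛ₀pos.ne'
          have key := kummer_arch_lower_bound_primes₂ Cw hCw hW₂ L hLprime (by omega) e hΛ1
            (fun q hq => hlogP q (hLsub hq)) hBₑ1 hBₑ hne
          rw [← hΛ₀eq', abs_of_pos hΛ₀pos] at key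
          -- `−log Λ₀ < Cw(#L) Λ^{#L} (log(eBₑ) + log 2Λ) log 2Λ / (log 2)^{#L+1} ≤ 192 C' Λ⁵ Y`
          have hCn : Cw L.card ≤ C' := hCle _ hL2 (by omega)
          have hCn0 : 0 ≤ Cw L.card := hCw _
          have hneg : -Real.log Λ₀ ≤ 192 * C' * Λ ^ 5 * Y := by
            have hsum : Real.log (Real.exp 1 * Bₑ) + Real.log (2 * Λ) ≤ 6 * Λ * Y := by
              have h1' : 2 * Λ ≤ 2 * Λ * Y := le_mul_of_one_le_right (by linarith) hY1
              have h2' : Y ≤ Λ * Y := le_mul_of_one_le_left (by linarith) hΛ1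
              have h3' : 6 * Λ * Y = 2 * Λ * Y + 4 * (Λ * Y) := by ring
              linarith only [h1', h2', h3', hlogBₑ, hlog2Λ]
            have hsum0 : 0 ≤ Real.log (Real.exp 1 * Bₑ) + Real.log (2 * Λ) := by linarith
            have h' : Cw L.card * Λ ^ L.card * (Real.log (Real.exp 1 * Bₑ) + Real.log (2 * Λ)) *
                Real.log (2 * Λ) / Real.log 2 ^ (L.card + 1) ≤
                C' * Λ ^ 3 * (6 * Λ * Y) * (2 * Λ) * 16 := by
              rw [div_eq_mul_one_div]
              apply mul_le_mul _ (hinv' _ hL3) (by positivity) (by positivity)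
              apply mul_le_mul _ hlog2Λ hlog2Λ0 (by positivity)
              exact mul_le_mul (mul_le_mul hCn (hΛpow _ hL3) (by positivity) (by positivity))
                hsum hsum0 (by positivity)
            have h'' : C' * Λ ^ 3 * (6 * Λ * Y) * (2 * Λ) * 16 = 192 * C' * Λ ^ 5 * Y := by ring
            linarith only [h', h'', key]
          obtain ⟨-, -, -, hA4, -⟩ := regimeIIK_arith (Hs := 1 + 6 * K * J ^ 2 * τ * Y) hC'1 hD1
            hK hJ1 hτ1 hΛ1 hY1 le_rfl
          calc y ≤ 2 + 2 * (192 * C' * Λ ^ 5 * Y) := by linarith only [hstar, hneg]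
            _ ≤ 1800 * (C' * D * K * J ^ 2 * τ * Λ ^ 6) * Y ^ 2 := hA4
            _ = M * Y ^ 2 := hMeq
        · -- exactly one large prime and `β = 1`: `Λ₀ = e log q₀ ≥ 1/2`
          have hL1 : L.card = 1 := by have := hLne.card_pos; omega
          obtain ⟨q₀, hLq₀⟩ := Finset.card_eq_one.mp hL1
          have hq₀L : q₀ ∈ L := by rw [hLq₀]; exact Finset.mem_singleton_self q₀
          have hq₀p := hLprime q₀ hq₀L
          have hΛ₀q : Λ₀ = (e q₀ : ℝ) * Real.log q₀ := by rw [hΛ₀eq', hLq₀, Finset.sum_singleton]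
          have hlogq₀ : Real.log 2 ≤ Real.log q₀ :=
            Real.log_le_log two_pos (by exact_mod_cast hq₀p.two_le)
          have hlog2' : (1 / 2 : ℝ) < Real.log 2 := by have := Real.log_two_gt_d9; linarith
          have hlogq₀0 : 0 < Real.log q₀ := by linarith only [hlogq₀, hlog2']
          have he1 : (1 : ℝ) ≤ e q₀ := by
            have hpos : (0 : ℝ) < e q₀ := by
              by_contra hle
              push Not at hle
              have h' : Λ₀ ≤ 0 := by rw [hΛ₀q]; exact mul_nonpos_of_nonpos_of_nonneg hle hlogq₀0.le
              linarith only [h', hΛ₀pos]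
            exact_mod_cast (show (1 : ℤ) ≤ e q₀ by exact_mod_cast hpos)
          have hΛ₀ge : 1 / 2 ≤ Λ₀ := by
            rw [hΛ₀q]
            calc (1 / 2 : ℝ) ≤ 1 * Real.log q₀ := by linarith only [hlogq₀, hlog2']
              _ ≤ (e q₀ : ℝ) * Real.log q₀ := mul_le_mul_of_nonneg_right he1 hlogq₀0.le
          have hneg : -Real.log Λ₀ ≤ 1 := by
            have h' : Real.log (1 / 2) ≤ Real.log Λ₀ := Real.log_le_log (by norm_num) hΛ₀ge
            have h12 : Real.log (1 / 2) = -Real.log 2 := by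
              rw [one_div, Real.log_inv]
            have h2 := Real.log_two_lt_d9
            linarith only [h', h12, h2]
          obtain ⟨-, -, hA3, -, -⟩ := regimeIIK_arith (Hs := 1 + 6 * K * J ^ 2 * τ * Y) hC'1 hD1
            hK hJ1 hτ1 hΛ1 hY1 le_rfl
          calc y ≤ 4 := by linarith only [hstar, hneg]
            _ ≤ 1800 * (C' * D * K * J ^ 2 * τ * Λ ^ 6) * Y ^ 2 := hA3
            _ = M * Y ^ 2 := hMeq
      · -- `β ≠ 1`: the archimedean bound with generators `L ∪ {β₀}`, `β = β₀^{2ʲ}`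
        obtain ⟨β₀, j, hβ₀pos, hβ₀1, hβ₀sq, hββ₀⟩ := exists_eq_pow_two_pow_of_pos hβpos hβ1
        -- `log β = 2ʲ log β₀`
        have hlogβ : Real.log (β : ℝ) = ((2 ^ j : ℕ) : ℤ) * Real.log (β₀ : ℝ) := by
          rw [hββ₀, Rat.cast_pow, Real.log_pow]; push_cast; ring
        have hne : ((2 ^ j : ℕ) : ℤ) * Real.log (β₀ : ℝ) + ∑ q ∈ L, (e q : ℝ) * Real.log q ≠ 0 := by
          have : (((2 ^ j : ℕ) : ℤ) : ℝ) * Real.log (β₀ : ℝ) = Real.log (β : ℝ) := by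
            rw [hlogβ]
          rw [this, ← hΛ₀eq]; exact hΛ₀pos.ne'
        -- `β₀` is a unit at the large primes
        have hν : ∀ p ∈ L, padicValRat p β₀ = 0 := by
          intro p hp
          have hpp : p.Prime := hLprime p hp
          haveI : Fact p.Prime := ⟨hpp⟩
          have hpS : p ∉ S := fun hpS => (not_le.mpr (hLτ p hp)) (hSτ p hpS)
          have hvβ : padicValRat p β = 0 := by
            rw [hβdef, padicValRat_finset_prod p S _ (fun q hq =>
              zpow_ne_zero _ (by exact_mod_cast (hPprime q (hSsub hq)).ne_zero))]
            refine Finset.sum_eq_zero fun q hq => ?_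
            have hqp : q.Prime := hPprime q (hSsub hq)
            haveI : Fact q.Prime := ⟨hqp⟩
            have hpq : p ≠ q := fun h => hpS (h ▸ hq)
            rw [padicValRat.zpow, padicValRat.of_nat, padicValNat_primes hpq]
            simp
          rw [hββ₀, padicValRat.pow] at hvβ
          rcases mul_eq_zero.mp hvβ with h0 | h0
          · exact absurd h0 (by positivity)
          · exact h0
        -- heights: `h(β₀) ≤ h(β) ≤ 6 K J² τ Y`, `2ʲ ≤ 2 h(β)`
        set Hs : ℝ := max 1 (logHeight₁ β) with hHsdef
        have hHs1 : 1 ≤ Hs := le_max_left _ _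
        have hhβ := logHeight₁_smooth_le_placeBounds hK hpad hpadc h h1 S hSsub hSτ
        have h6 : logHeight₁ β ≤ 6 * K * J ^ 2 * τ * Y := by
          calc logHeight₁ β ≤ S.card * ((theta K a b 0 + theta K a c 0) * (3 * τ * Y)) := hhβ
            _ ≤ J * ((K * J + K * J) * (3 * τ * Y)) := by
                apply mul_le_mul hcardS _ (by positivity) (zero_le_one.trans hJ1)
                exact mul_le_mul_of_nonneg_right (add_le_add hΘab hΘac) (by positivity)
            _ = 6 * K * J ^ 2 * τ * Y := by ring
        have h60 : 0 ≤ 6 * K * J ^ 2 * τ * Y := by positivity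
        have hh0 : 0 ≤ logHeight₁ β := zero_le_logHeight₁ _
        have hHsle : Hs ≤ 1 + 6 * K * J ^ 2 * τ * Y :=
          max_le (by linarith only [h60]) (by linarith only [h6, hh0])
        have hββ₀h : logHeight₁ β = (2 ^ j : ℕ) * logHeight₁ β₀ := by
          rw [hββ₀, logHeight₁_pow]
        have hh₀pos : Real.log 2 ≤ logHeight₁ β₀ := log_two_le_logHeight₁ hβ₀pos hβ₀1
        have hlog2' : (1 / 2 : ℝ) < Real.log 2 := by have := Real.log_two_gt_d9; linarith
        have h2j : ((2 ^ j : ℕ) : ℝ) ≤ 2 * logHeight₁ β := by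
          rw [hββ₀h]
          have : (0 : ℝ) ≤ (2 ^ j : ℕ) := by positivity
          nlinarith
        have hh₀le : logHeight₁ β₀ ≤ logHeight₁ β := by
          rw [hββ₀h]
          have h1' : (1 : ℝ) ≤ (2 ^ j : ℕ) := by exact_mod_cast Nat.one_le_two_pow
          have : 0 ≤ logHeight₁ β₀ := zero_le_logHeight₁ _
          nlinarith
        -- the coefficients bound `B = Bₑ (1 + 2 h(β))`
        set B : ℝ := Bₑ * (1 + 2 * logHeight₁ β) with hBdef
        have hB1' : 1 ≤ 1 + 2 * logHeight₁ β := by linarith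
        have hB1 : 1 ≤ B := one_le_mul_of_one_le_of_one_le hBₑ1 hB1'
        have hBₑB : Bₑ ≤ B := le_mul_of_one_le_right (by linarith) hB1'
        have hBe : ∀ p ∈ L, (|e p| : ℝ) ≤ B := fun p hp => (hBₑ p hp).trans hBₑB
        have hBm : (|((2 ^ j : ℕ) : ℤ)| : ℝ) ≤ B := by
          have : (|((2 ^ j : ℕ) : ℤ)| : ℝ) = ((2 ^ j : ℕ) : ℝ) := by push_cast; exact abs_of_nonneg (by positivity)
          rw [this]
          calc ((2 ^ j : ℕ) : ℝ) ≤ 1 + 2 * logHeight₁ β := by linarith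
            _ = 1 * (1 + 2 * logHeight₁ β) := (one_mul _).symm
            _ ≤ Bₑ * (1 + 2 * logHeight₁ β) := mul_le_mul_of_nonneg_right hBₑ1 (by linarith)
        have key := kummer_arch_lower_bound₂ Cw hCw hW₂ L hLprime e hβ₀pos hβ₀1 hβ₀sq hν
          ((2 ^ j : ℕ) : ℤ) hΛ1 (fun q hq => hlogP q (hLsub hq)) hB1 hBe hBm hne
        have hΛ₀eq'' : Λ₀ = (((2 ^ j : ℕ) : ℤ) : ℝ) * Real.log (β₀ : ℝ) +
            ∑ q ∈ L, (e q : ℝ) * Real.log q := by rw [hΛ₀eq, hlogβ]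
        rw [← hΛ₀eq'', abs_of_pos hΛ₀pos] at key
        have hL2 : 2 ≤ L.card + 1 := by have := hLne.card_pos; omega
        have hCn : Cw (L.card + 1) ≤ C' := hCle _ hL2 (by omega)
        have hCn0 : 0 ≤ Cw (L.card + 1) := hCw _
        -- the pieces: `H = max(h(β₀), Λ) ≤ Λ Hs`, the logarithms `≤ D Λ Y`
        set H : ℝ := max (logHeight₁ β₀) Λ with hHdef
        have hH1 : 1 ≤ H := hΛ1.trans (le_max_right _ _)
        have hHle : H ≤ Λ * Hs := by
          refine max_le ?_ (le_mul_of_one_le_right hΛ0.le hHs1)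
          calc logHeight₁ β₀ ≤ logHeight₁ β := hh₀le
            _ ≤ Hs := le_max_right _ _
            _ = 1 * Hs := (one_mul _).symm
            _ ≤ Λ * Hs := mul_le_mul_of_nonneg_right hΛ1 (by linarith)
        have hHle' : H ≤ Λ * (1 + 6 * K * J ^ 2 * τ * Y) :=
          hHle.trans (mul_le_mul_of_nonneg_left hHsle hΛ0.le)
        obtain ⟨hlogB, hlogH⟩ := regimeIIK_logs (h := logHeight₁ β) hK hJ1 hC₁1 hR1 rfl hJle rfl
          hY1 hy0.le hlogBₑ hh0 h6
        have hlogB' : Real.log (Real.exp 1 * B) ≤ D * Λ * Y := by rw [hBdef, hBₑdef]; exact hlogB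
        have hlog2H : Real.log (2 * H) ≤ D * Λ * Y := by
          have : Real.log (2 * H) ≤ Real.log (2 * (Λ * (1 + 6 * K * J ^ 2 * τ * Y))) :=
            Real.log_le_log (by linarith) (by linarith)
          exact this.trans hlogH
        have hsum : Real.log (Real.exp 1 * B) + Real.log (2 * H) ≤ 2 * D * Λ * Y := by linarith
        have hsum0 : 0 ≤ Real.log (Real.exp 1 * B) + Real.log (2 * H) := by
          have h1' : 0 ≤ Real.log (Real.exp 1 * B) :=
            Real.log_nonneg (one_le_mul_of_one_le_of_one_le (by linarith) hB1)
          have h2' : 0 ≤ Real.log (2 * H) := Real.log_nonneg (by linarith)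
          linarith
        have hneg : -Real.log Λ₀ ≤ 128 * C' * D * Λ ^ 6 * Hs * Y := by
          have h' : Cw (L.card + 1) * (Λ ^ L.card * H) *
              (Real.log (Real.exp 1 * B) + Real.log (2 * H)) * Real.log (2 * Λ) /
              Real.log 2 ^ (L.card + 2) ≤
              C' * (Λ ^ 3 * (Λ * Hs)) * (2 * D * Λ * Y) * (2 * Λ) * 32 := by
            rw [div_eq_mul_one_div]
            apply mul_le_mul _ (hinv _ hL3) (by positivity) (by positivity)
            apply mul_le_mul _ hlog2Λ hlog2Λ0 (by positivity)
            apply mul_le_mul _ hsum hsum0 (by positivity)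
            exact mul_le_mul hCn (mul_le_mul (hΛpow _ hL3) hHle (by positivity) (by positivity))
              (by positivity) (by positivity)
          have h'' : C' * (Λ ^ 3 * (Λ * Hs)) * (2 * D * Λ * Y) * (2 * Λ) * 32 =
              128 * C' * D * Λ ^ 6 * Hs * Y := by ring
          linarith only [h', h'', key]
        obtain ⟨-, -, -, -, hA5⟩ := regimeIIK_arith hC'1 hD1 hK hJ1 hτ1 hΛ1 hY1 hHsle
        calc y ≤ 2 + 2 * (128 * C' * D * Λ ^ 6 * Hs * Y) := by linarith only [hstar, hneg]
          _ ≤ 1800 * (C' * D * K * J ^ 2 * τ * Λ ^ 6) * Y ^ 2 := hA5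
          _ = M * Y ^ 2 := hMeq
  -- absorb `J² τ ≤ C₁² R^{7/24}`
  have hJ2τ : J ^ 2 * τ ≤ C₁ ^ 2 * (R : ℝ) ^ (7 / 24 : ℝ) := by
    have h48 : ((R : ℝ) ^ (1 / 48 : ℝ)) ^ 2 * (R : ℝ) ^ (1 / 4 : ℝ) = (R : ℝ) ^ (7 / 24 : ℝ) := by
      rw [← Real.rpow_mul_natCast hR0.le, ← Real.rpow_add hR0]; norm_num
    calc J ^ 2 * τ ≤ (C₁ * (R : ℝ) ^ (1 / 48 : ℝ)) ^ 2 * τ :=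
          mul_le_mul_of_nonneg_right (pow_le_pow_left₀ (zero_le_one.trans hJ1) hJle 2)
            (zero_le_one.trans hτ1)
      _ = C₁ ^ 2 * (((R : ℝ) ^ (1 / 48 : ℝ)) ^ 2 * (R : ℝ) ^ (1 / 4 : ℝ)) := by rw [hτdef]; ring
      _ = C₁ ^ 2 * (R : ℝ) ^ (7 / 24 : ℝ) := by rw [h48]
  have hD0 : 0 ≤ D := zero_le_one.trans hD1
  calc y ≤ M * Y ^ 2 := hyM
    _ = 1800 * C' * D * K * (J ^ 2 * τ) * Λ ^ 6 * Y ^ 2 := by rw [hMdef, hPₘ]; ring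
    _ ≤ 1800 * C' * D * K * (C₁ ^ 2 * (R : ℝ) ^ (7 / 24 : ℝ)) * Λ ^ 6 * Y ^ 2 := by
        apply mul_le_mul_of_nonneg_right _ (by positivity)
        apply mul_le_mul_of_nonneg_right _ (by positivity)
        exact mul_le_mul_of_nonneg_left hJ2τ (by positivity)
    _ = 1800 * max 1 (max (max (Cw 2) (Cw 3)) (Cw 4)) *
          (Real.log 6 + Real.log K + 2 * Real.log C₁ + 8) * K * C₁ ^ 2 *
          (rad a b c : ℝ) ^ (7 / 24 : ℝ) * max 1 (Real.log (rad a b c : ℕ)) ^ 6 * Y ^ 2 := by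
        rw [hC', hCmax, hDdef, hΛdef, hRdef]; ring

end RegimeTwoKummerPlaceBounds

section AssemblyKummerPlaceBounds

variable {K : ℝ}

/-- **Stewart–Yu's `(1/3, 3)` from the `p`-adic clause and the `E = 2` form of a Kummer-conditional
archimedean bound with an arbitrary constant.** If the `p`-adic clause of Pasten's approximation bound holds
with some absolute `K ≥ 1`, and linear forms in `≤ 4` logarithms of positive rationals
satisfying the `2`-Kummer condition admit ANY lower bound of the shape of Waldschmidt's
Proposition 3.8 (`log |Λ| > −Cw(n) V₁⋯Vₙ (W + log(EVₙ)) log(EV⁺ₙ₋₁) (log E)^{-n-1}`, no condition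
on the constants `Cw(n) ≥ 0`), then `BakerShapeBound (1/3) 3`: `log c ≤ κ R^{1/3} (log R)³` for
all abc triples. Proof: w.l.o.g. `a ≤ b`; the triple `1 + 1 = 2` directly; if `c ≤ a²`, the cube
of the three `p`-adic routes (`log_le_of_le_sq`, no archimedean input); if `a² < c`, the Kummer
second regime (`log_le_of_sq_lt_kummer₂`, `regimeII_endgame6`).
[cite: StewartYu2001, Theorem 1] [cite: Waldschmidt1980, Prop 3.8 (p. 274)] -/
theorem bakerShapeBound_third_three_of_placeBounds_kummerArchBound₂ (hK : 1 ≤ K)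
    (hpad : ∀ {a b c : ℕ}, IsABCTriple a b c → ∀ {p : ℕ}, p.Prime → p ∣ a →
      (a.factorization p : ℝ) * Real.log p < theta K b c 0 *
        ((p / Real.log p) * (Real.log p + Real.log (max (Real.exp 1) (2 * Real.log c)))))
    (hpadc : ∀ {a b c : ℕ}, IsABCTriple a b c → 1 < a * b → ∀ {p : ℕ}, p.Prime → p ∣ c →
      (c.factorization p : ℝ) * Real.log p < theta K a b 0 *
        ((p / Real.log p) * (Real.log p + Real.log (max (Real.exp 1) (2 * Real.log c)))))
    (Cw : ℕ → ℝ) (hCw : ∀ n, 0 ≤ Cw n)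
    (hW₂ : ∀ (n : ℕ) (α : Fin (n + 1) → ℚ) (b : Fin (n + 1) → ℤ) (V : Fin (n + 1) → ℝ) (W : ℝ),
      (∀ j, 0 < α j ∧ α j ≠ 1) →
      Module.finrank ℚ ↥(IntermediateField.adjoin ℚ
          (Set.range fun j => Real.sqrt (α j : ℝ))) = 2 ^ (n + 1) →
      Monotone V → 1 ≤ V 0 →
      (∀ j, max (logHeight₁ (α j)) |Real.log (α j : ℝ)| ≤ V j) →
      0 < W → (∀ j, logHeight₁ (b j : ℚ) ≤ W) →
      ∑ j, (b j : ℝ) * Real.log (α j : ℝ) ≠ 0 →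
      Real.exp (-(Cw (n + 1) * (∏ j, V j) * (W + Real.log (2 * V (Fin.last n))) *
          Real.log (2 * (if n = 0 then 1 else V ⟨n - 1, by omega⟩)) / Real.log 2 ^ (n + 2))) <
        |∑ j, (b j : ℝ) * Real.log (α j : ℝ)|) :
    BakerShapeBound (1 / 3) 3 := by
  obtain ⟨Ca, hCa1, hCa⟩ := exists_prod_mul_log_sq_div_le (show (0 : ℝ) ≤ 4 * K ^ 2 by positivity)
  obtain ⟨C₁, hC₁1, hC₁⟩ := exists_prod_two_mul_max_log_le (zero_le_one.trans hK)
  set κ₁ : ℝ := 64 * K ^ 3 * (2 * Ca) * (Real.log (16 * K ^ 3 * (2 * Ca)) + 3) with hκ₁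
  set M₀ : ℝ := 1800 * max 1 (max (max (Cw 2) (Cw 3)) (Cw 4)) *
    (Real.log 6 + Real.log K + 2 * Real.log C₁ + 8) * K * C₁ ^ 2 with hM₀
  set κ₂ : ℝ := 32 * 240 ^ 5 * M₀ * (Real.log (32 * M₀) + 7) ^ 2 with hκ₂
  have hK3 : 1 ≤ K ^ 3 := one_le_pow₀ hK
  have hCa2 : 1 ≤ 2 * Ca := by linarith
  have hc₀0 : 0 ≤ Real.log (16 * K ^ 3 * (2 * Ca)) := Real.log_nonneg (by nlinarith)
  have hκ₁192 : (192 : ℝ) ≤ κ₁ := by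
    have h3 : (3 : ℝ) ≤ Real.log (16 * K ^ 3 * (2 * Ca)) + 3 := by linarith
    calc (192 : ℝ) = 64 * 1 * 1 * 3 := by norm_num
      _ ≤ 64 * K ^ 3 * (2 * Ca) * (Real.log (16 * K ^ 3 * (2 * Ca)) + 3) :=
          mul_le_mul (mul_le_mul (mul_le_mul_of_nonneg_left hK3 (by norm_num)) hCa2 zero_le_one
            (by positivity)) h3 (by norm_num) (by positivity)
  have hD1 : 1 ≤ Real.log 6 + Real.log K + 2 * Real.log C₁ + 8 := by
    have h6 : 0 ≤ Real.log 6 := Real.log_nonneg (by norm_num)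
    have hK' : 0 ≤ Real.log K := Real.log_nonneg hK
    have hC₁' : 0 ≤ Real.log C₁ := Real.log_nonneg hC₁1
    linarith
  have hM₀1 : 1 ≤ M₀ := by
    have h1 : (1 : ℝ) ≤ max 1 (max (max (Cw 2) (Cw 3)) (Cw 4)) := le_max_left _ _
    have h2 : (1 : ℝ) ≤ C₁ ^ 2 := one_le_pow₀ hC₁1
    calc (1 : ℝ) ≤ 1800 * 1 * 1 * 1 * 1 := by norm_num
      _ ≤ 1800 * max 1 (max (max (Cw 2) (Cw 3)) (Cw 4)) *
          (Real.log 6 + Real.log K + 2 * Real.log C₁ + 8) * K * C₁ ^ 2 :=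
          mul_le_mul (mul_le_mul (mul_le_mul (mul_le_mul_of_nonneg_left h1 (by norm_num)) hD1
            zero_le_one (by positivity)) hK zero_le_one (by positivity)) h2 zero_le_one
            (by positivity)
  have hκ₂0 : 0 ≤ κ₂ := by
    have : 0 ≤ M₀ := zero_le_one.trans hM₀1
    positivity
  -- w.l.o.g. `a ≤ b`
  suffices key : ∀ a b c : ℕ, IsABCTriple a b c → a ≤ b →
      Real.log c ≤ max κ₁ κ₂ * (rad a b c : ℝ) ^ (1 / 3 : ℝ) * Real.log (rad a b c : ℕ) ^ 3 by
    refine ⟨max κ₁ κ₂, fun a b c h => ?_⟩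
    rcases le_total a b with hab | hba
    · exact key a b c h hab
    · have := key b a c h.swap hba
      rwa [rad_swap] at this
  intro a b c h hab
  obtain ⟨ha, hb, habc, hcop⟩ := id h
  have hR2 : (2 : ℝ) ≤ (rad a b c : ℝ) := by
    have : 2 ≤ rad a b c := by
      rw [rad_def, Nat.two_le_radical_iff]
      calc 2 ≤ c := by omega
        _ ≤ a * b * c := Nat.le_mul_of_pos_left c (Nat.mul_pos ha hb)
    exact_mod_cast this
  set R : ℝ := ((rad a b c : ℕ) : ℝ) with hR
  have hlogR : 0 ≤ Real.log R := Real.log_nonneg (by linarith)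
  have hRL : 0 ≤ R ^ (1 / 3 : ℝ) * Real.log R ^ 3 := by positivity
  by_cases h1 : 1 < a * b
  · rcases le_or_gt (c : ℝ) ((a : ℝ) ^ 2) with hca | hac2
    · -- first regime: `p`-adic routes only
      have h' := log_le_of_le_sq_placeBounds hK hpad hpadc hCa1 hCa h hab hca
      calc Real.log c ≤ κ₁ * R ^ (1 / 3 : ℝ) * Real.log R ^ 3 := h'
        _ = κ₁ * (R ^ (1 / 3 : ℝ) * Real.log R ^ 3) := by ring
        _ ≤ max κ₁ κ₂ * (R ^ (1 / 3 : ℝ) * Real.log R ^ 3) :=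
            mul_le_mul_of_nonneg_right (le_max_left _ _) hRL
        _ = max κ₁ κ₂ * R ^ (1 / 3 : ℝ) * Real.log R ^ 3 := by ring
    · -- second regime, Kummer version
      have h' := log_le_of_sq_lt_kummer₂_placeBounds hK hpad hpadc Cw hCw hW₂ hC₁1 hC₁ h hab h1 hac2
      have h'' : Real.log c ≤ M₀ * R ^ (7 / 24 : ℝ) * max 1 (Real.log R) ^ 6 *
          Real.log (max (Real.exp 1) (2 * Real.log c)) ^ 2 := by
        rw [hM₀]; exact h'
      have h3 := regimeII_endgame6 hM₀1 hR2 h''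
      calc Real.log c ≤ κ₂ * R ^ (1 / 3 : ℝ) * Real.log R ^ 3 := by rw [hκ₂]; exact h3
        _ = κ₂ * (R ^ (1 / 3 : ℝ) * Real.log R ^ 3) := by ring
        _ ≤ max κ₁ κ₂ * (R ^ (1 / 3 : ℝ) * Real.log R ^ 3) :=
            mul_le_mul_of_nonneg_right (le_max_right _ _) hRL
        _ = max κ₁ κ₂ * R ^ (1 / 3 : ℝ) * Real.log R ^ 3 := by ring
  · -- the triple `1 + 1 = 2`
    have hab1 : a * b = 1 := by
      have : 1 ≤ a * b := Nat.mul_pos ha hb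
      omega
    have ha1 : a = 1 := Nat.eq_one_of_mul_eq_one_right hab1
    have hb1 : b = 1 := Nat.eq_one_of_mul_eq_one_left hab1
    have hc2 : c = 2 := by omega
    have hκ : (192 : ℝ) ≤ max κ₁ κ₂ := hκ₁192.trans (le_max_left _ _)
    have hR13 : 1 ≤ R ^ (1 / 3 : ℝ) := Real.one_le_rpow (by linarith) (by norm_num)
    have hL : (0.69 : ℝ) ≤ Real.log R :=
      le_trans (by have := Real.log_two_gt_d9; linarith) (Real.log_le_log two_pos hR2)
    have hL3 : (0.69 : ℝ) ^ 3 ≤ Real.log R ^ 3 := pow_le_pow_left₀ (by norm_num) hL 3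
    have hlog2 : Real.log 2 ≤ 0.7 := by have := Real.log_two_lt_d9; linarith
    calc Real.log c = Real.log 2 := by rw [hc2]; norm_num
      _ ≤ 0.7 := hlog2
      _ ≤ 192 * 1 * (0.69 : ℝ) ^ 3 := by norm_num
      _ ≤ max κ₁ κ₂ * R ^ (1 / 3 : ℝ) * Real.log R ^ 3 :=
          mul_le_mul (mul_le_mul hκ hR13 zero_le_one (by linarith)) hL3 (by norm_num)
            (by positivity)

/-- **`BakerMethodBounds` from the `p`-adic clause (constant `K ≥ 1`) and the `E = 2` form of a
Kummer-conditional archimedean bound with an arbitrary constant.**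
[cite: StewartYu2001, Theorem 1] [cite: Waldschmidt1980, Prop 3.8 (p. 274)] -/
theorem BakerMethodBounds_of_placeBounds_kummerArchBound₂ (hK : 1 ≤ K)
    (hpad : ∀ {a b c : ℕ}, IsABCTriple a b c → ∀ {p : ℕ}, p.Prime → p ∣ a →
      (a.factorization p : ℝ) * Real.log p < theta K b c 0 *
        ((p / Real.log p) * (Real.log p + Real.log (max (Real.exp 1) (2 * Real.log c)))))
    (hpadc : ∀ {a b c : ℕ}, IsABCTriple a b c → 1 < a * b → ∀ {p : ℕ}, p.Prime → p ∣ c →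
      (c.factorization p : ℝ) * Real.log p < theta K a b 0 *
        ((p / Real.log p) * (Real.log p + Real.log (max (Real.exp 1) (2 * Real.log c)))))
    (Cw : ℕ → ℝ) (hCw : ∀ n, 0 ≤ Cw n)
    (hW₂ : ∀ (n : ℕ) (α : Fin (n + 1) → ℚ) (b : Fin (n + 1) → ℤ) (V : Fin (n + 1) → ℝ) (W : ℝ),
      (∀ j, 0 < α j ∧ α j ≠ 1) →
      Module.finrank ℚ ↥(IntermediateField.adjoin ℚ
          (Set.range fun j => Real.sqrt (α j : ℝ))) = 2 ^ (n + 1) →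
      Monotone V → 1 ≤ V 0 →
      (∀ j, max (logHeight₁ (α j)) |Real.log (α j : ℝ)| ≤ V j) →
      0 < W → (∀ j, logHeight₁ (b j : ℚ) ≤ W) →
      ∑ j, (b j : ℝ) * Real.log (α j : ℝ) ≠ 0 →
      Real.exp (-(Cw (n + 1) * (∏ j, V j) * (W + Real.log (2 * V (Fin.last n))) *
          Real.log (2 * (if n = 0 then 1 else V ⟨n - 1, by omega⟩)) / Real.log 2 ^ (n + 2))) <
        |∑ j, (b j : ℝ) * Real.log (α j : ℝ)|) :
    BakerMethodBounds :=
  bakerShapeBound_third_three_of_placeBounds_kummerArchBound₂ hK hpad hpadc Cw hCw hW₂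

end AssemblyKummerPlaceBounds

end Literature.Barriers.ABC

end
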